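import Literature.NumberTheory.IwasawaTheory.FukudaNakayamaFinite
import Literature.NumberTheory.IwasawaTheory.FukudaGroupStep
import Literature.NumberTheory.IwasawaTheory.ZpExtensionLayerRamificationDichotomy
import Literature.NumberTheory.IwasawaTheory.ZpExtensionLayerTotallyRamifiedPrime
import Literature.NumberTheory.IwasawaTheory.FukudaCountingLemmas
import Literature.NumberTheory.IwasawaTheory.FukudaPHilbertInclusion
import Literature.NumberTheory.EllipticCurves.ZpExtensionLayerCharacter
import HarnessLib

/-!
# Fukuda 1994, Theorem 1 (1): PROOF of `fukuda1994_thm1_classNumberPExp_const_of_succ_eq` at finite level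
# (assembly of the bricks (N) `FukudaNakayamaFinite`, (G) `FukudaGroupStep`, (R) `ZpExtensionLayerRamificationDichotomy`,
# (C) `FukudaCountingLemmas`, (D) `FukudaPHilbertInclusion`)

Topic `NumberTheory/IwasawaTheory` (namespace = path). THEOREM-ONLY file (no definition, no named fact, no `sorry`), written by the
prover seat `bsd-potss-k8t-c4` g19 (cell `bsd-potss`; Fukuda road of stmt-BirchSwinnertonDyer-19982; closes nothing). It discharges the
named fact `Literature.NumberTheory.IwasawaTheory.fukuda1994_thm1_classNumberPExp_const_of_succ_eq` (`ClassicalMuInvariant.lean` §5)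
by `fukuda1994_thm1_classNumberPExp_const_of_succ_eq_holds` (the step theorem `classNumberPExp_add_two_eq` is one long elaboration
over a tower of four number fields, hence its raised `maxHeartbeats`; all auxiliary objects are kept opaque — `obtain ⟨X, hX⟩ := ⟨_, rfl⟩` —
to keep unification cheap):
for a number field `K`, a prime `p`, a `ℤ_p`-extension `κ` of `K` with Fukuda index `n₀` (`TotallyRamifiedFrom κ n₀`), if
`e_{n+1} = e_n` for some `n ≥ n₀` then `e_m = e_n` for all `m ≥ n` (`e_m = ord_p h(K_m)`).

THE STEP `e_{n+1} = e_n ⇒ e_{n+2} = e_n` (then induction). `B = K_n ⊆ F₁ = K_{n+1} ⊆ F = K_{n+2}` (cyclic of degree `p²` over `B`),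
`E = H_F` the Hilbert class field of `F` (a Galois extension of `B`, `hilbertClassField.isGalois_of_isGalois`), `G = Gal(E/B)`,
`A = Gal(E/F) = ker(G → Gal(F/B))` (abelian of order `h(F)`), `A₀ ≤ A` its prime-to-`p` part, `H_p = E^{A₀}` the `p`-Hilbert class
field of `F` (Galois over `B`), `G_p = Gal(H_p/B)`, `A' = Gal(H_p/F)` (order `p^{e_{n+2}}`), `G₁ = Gal(H_p/F₁)`. CLASS FIELD THEORY
(bricks (C), (D)): for `M ∈ {B, F₁}`, `[Gal(H_p/M) : Gal(H_p/M)'·⟨inertia⟩] = p^{e(M)}`. RAMIFICATION (brick (R) + Washington Lemma 13.3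
all `p`, brick (C) §1): every inertia group `I(𝔔) ≤ G_p` meets `A'` trivially (`H_p/F` unramified) and is trivial or a complement of `A'`
(`𝔔 ∩ F` unramified over `K` or totally ramified over `K_n`), and some `I(𝔔)` is a complement. GROUP THEORY (bricks (G)+(N)):
`[G₁ : N₁] = [G_p : N₀] ⇒ [G_p : N₀] = #A'`, i.e. `p^{e_{n+1}} = p^{e_n} ⇒ p^{e_n} = p^{e_{n+2}}`.

References: [Fukuda1994] T. Fukuda, *Remarks on ℤ_p-extensions of number fields*, Proc. Japan Acad. 70 A (1994), Thm. 1 (1), p. 264;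
[Washington1997] §13.3 Lemmas 13.14–13.18, Prop. 13.22; Lemma 13.3; [Lang1990] Ch. 3 §4; [Cox2013] §8.A Thm. 8.10.
-/

noncomputable section

open scoped NumberField IsMulCommutative
open NumberField IsDedekindDomain Field IntermediateField

namespace Literature.NumberTheory.IwasawaTheory

open Literature.NumberTheory.EllipticCurves Literature.NumberTheory.GaloisRepresentations
  Literature.NumberTheory.NumberFields

variable {K : Type} [Field K] [NumberField K] {p : ℕ} [hp : Fact p.Prime]

/-- A subgroup containing the commutator subgroup is normal. [folklore] -/
private theorem normal_of_commutator_le {G : Type*} [Group G] {N : Subgroup G} (h : ⁅(⊤ : Subgroup G), ⊤⁆ ≤ N) :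
    N.Normal :=
  ⟨fun m hm g => by
    have h2 := Subgroup.commutator_mem_commutator (Subgroup.mem_top g) (Subgroup.mem_top m)
    rw [commutatorElement_def] at h2
    have h1 : g * m * g⁻¹ = g * m * g⁻¹ * m⁻¹ * m := by group
    rw [h1]
    exact mul_mem (h h2) hm⟩

/-- Brick (D) with the `M`-algebra structure of `Hq` as an explicit argument (the assembly sees `Hq` through an intermediate
field of the top layer, whose inherited `M`-algebra instance is only definitionally the one of brick (D)). [folklore] -/
private theorem dvd_index_of_algebra_eq (M F : Type) [Field M] [NumberField M] [Field F] [NumberField F] [Algebra M F]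
    [IsGalois M F] (p : ℕ) [Fact p.Prime] (Hq : IntermediateField F (hilbertClassField F))
    (hmax : ∀ L : IntermediateField F (hilbertClassField F), (∃ k, Module.finrank F L = p ^ k) → L ≤ Hq)
    (alg : Algebra M Hq) (halg : alg = IntermediateField.algebra' Hq) (hG : @IsGalois M _ (↥Hq) _ alg) :
    letI := alg
    p ^ padicValNat p (classNumber M) ∣
      (⁅(⊤ : Subgroup (Hq ≃ₐ[M] Hq)), ⊤⁆ ⊔ ⨆ (Q : MaximalSpectrum (𝓞 Hq)), Q.asIdeal.inertia (Hq ≃ₐ[M] Hq)).index := by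
  subst halg
  exact pow_padicValNat_classNumber_dvd_index_commutator_sup_inertia M F p Hq hmax

set_option maxHeartbeats 40000000 in
set_option synthInstance.maxHeartbeats 400000 in
/-- **Fukuda's step: `e_{n+1} = e_n ⇒ e_{n+2} = e_{n+1}`** for a `ℤ_p`-extension with Fukuda index `n₀ ≤ n`.
[cite: Fukuda1994, Thm. 1 (1), p. 264 (proof)] [cite: Washington1997, §13.3 Lemmas 13.15, 13.18, Prop. 13.22] -/
theorem classNumberPExp_add_two_eq (κ : ZpExtension K p) {n₀ n : ℕ} (hκ : TotallyRamifiedFrom κ n₀) (hn : n₀ ≤ n)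
    (he : classNumberPExp κ (n + 1) = classNumberPExp κ n) :
    classNumberPExp κ (n + 2) = classNumberPExp κ (n + 1) := by
  classical
  -- ### the top layer `T = K_{n+2}` as a type; `B = K_n` and `F₁ = K_{n+1}` as intermediate fields of `T/K`
  haveI : FiniteDimensional K (κ.layer n) := κ.finiteDimensional_layer_holds n
  haveI : FiniteDimensional K (κ.layer (n + 1)) := κ.finiteDimensional_layer_holds (n + 1)
  haveI : FiniteDimensional K (κ.layer (n + 2)) := κ.finiteDimensional_layer_holds (n + 2)
  haveI : IsGalois K (κ.layer n) := κ.isGalois_layer_holds n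
  haveI : IsGalois K (κ.layer (n + 1)) := κ.isGalois_layer_holds (n + 1)
  haveI : IsGalois K (κ.layer (n + 2)) := κ.isGalois_layer_holds (n + 2)
  haveI : NumberField (κ.layer n) := NumberField.of_module_finite K _
  haveI : NumberField (κ.layer (n + 1)) := NumberField.of_module_finite K _
  haveI : NumberField (κ.layer (n + 2)) := NumberField.of_module_finite K _
  have hBF1 : κ.layer n ≤ κ.layer (n + 1) := κ.layer_mono (Nat.le_succ n)
  have hF1F : κ.layer (n + 1) ≤ κ.layer (n + 2) := κ.layer_mono (Nat.le_succ (n + 1))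
  have hBF : κ.layer n ≤ κ.layer (n + 2) := hBF1.trans hF1F
  -- `T`, `Bi ≤ F1i ≤ ⊤` inside `T`
  obtain ⟨Bi, hBi⟩ : ∃ Bi : IntermediateField K (κ.layer (n + 2)), Bi = IntermediateField.restrict hBF := ⟨_, rfl⟩
  obtain ⟨F1i, hF1i⟩ : ∃ F1i : IntermediateField K (κ.layer (n + 2)), F1i = IntermediateField.restrict hF1F := ⟨_, rfl⟩
  have hBiF1i : Bi ≤ F1i := by
    intro x hx
    rw [hBi, IntermediateField.mem_restrict] at hx
    rw [hF1i, IntermediateField.mem_restrict]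
    exact hBF1 hx
  let eB : (κ.layer n) ≃ₐ[K] Bi := (IntermediateField.restrict_algEquiv hBF).trans (IntermediateField.equivOfEq hBi.symm)
  let eF1 : (κ.layer (n + 1)) ≃ₐ[K] F1i :=
    (IntermediateField.restrict_algEquiv hF1F).trans (IntermediateField.equivOfEq hF1i.symm)
  -- `F₁` over `B`: the same field `F1i`, with base `Bi` (kept opaque: only its defining equation is used)
  obtain ⟨F1e, hF1e⟩ : ∃ F1e : IntermediateField Bi (κ.layer (n + 2)), F1e = IntermediateField.extendScalars hBiF1i :=
    ⟨_, rfl⟩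
  have hmemF1e : ∀ x : (κ.layer (n + 2)), x ∈ F1e ↔ x ∈ F1i := fun x => by
    rw [hF1e, IntermediateField.mem_extendScalars]
  let eF1e : F1i ≃+* F1e :=
    { toFun := fun x => ⟨x, (hmemF1e _).mpr x.2⟩
      invFun := fun x => ⟨x, (hmemF1e _).mp x.2⟩
      left_inv := fun _ => rfl
      right_inv := fun _ => rfl
      map_mul' := fun _ _ => rfl
      map_add' := fun _ _ => rfl }
  haveI : FiniteDimensional K Bi := LinearEquiv.finiteDimensional eB.toLinearEquiv
  haveI : FiniteDimensional K F1i := LinearEquiv.finiteDimensional eF1.toLinearEquiv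
  haveI : IsGalois K Bi := IsGalois.of_algEquiv eB
  haveI : IsGalois K F1i := IsGalois.of_algEquiv eF1
  haveI : NumberField Bi := NumberField.of_module_finite K _
  haveI : NumberField F1i := NumberField.of_module_finite K _
  haveI hF1efd : FiniteDimensional K F1e := by
    have : FiniteDimensional K (F1e.restrictScalars K) := by rw [hF1e, IntermediateField.extendScalars_restrictScalars]; infer_instance
    exact this
  haveI : IsGalois K F1e := by
    have : IsGalois K (F1e.restrictScalars K) := by rw [hF1e, IntermediateField.extendScalars_restrictScalars]; infer_instance
    exact this
  haveI : NumberField F1e := NumberField.of_module_finite K _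
  haveI : IsGalois Bi (κ.layer (n + 2)) := IsGalois.tower_top_of_isGalois K Bi (κ.layer (n + 2))
  haveI : IsGalois Bi F1e := IsGalois.tower_top_of_isGalois K Bi F1e
  haveI : IsScalarTower K F1e (κ.layer (n + 2)) := IsScalarTower.of_algebraMap_eq fun _ => rfl
  haveI : IsGalois F1e (κ.layer (n + 2)) := IsGalois.tower_top_of_isGalois K F1e (κ.layer (n + 2))
  have hp0 : 0 < p := hp.out.pos
  have hdegKB : Module.finrank K Bi = p ^ n := by rw [← eB.toLinearEquiv.finrank_eq, κ.finrank_layer_holds n]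
  have hdegBF : Module.finrank Bi (κ.layer (n + 2)) = p ^ 2 := by
    have h := Module.finrank_mul_finrank K Bi (κ.layer (n + 2))
    rw [hdegKB, κ.finrank_layer_holds (n + 2), pow_add] at h
    exact Nat.eq_of_mul_eq_mul_left (pow_pos hp0 n) h
  have hdegBF1 : Module.finrank Bi F1e = p := by
    have h := Module.finrank_mul_finrank K Bi F1e
    have h2 : Module.finrank K F1e = p ^ (n + 1) := by
      have : Module.finrank K (F1e.restrictScalars K) = Module.finrank K F1i := by
        rw [hF1e, IntermediateField.extendScalars_restrictScalars]
      rw [← κ.finrank_layer_holds (n + 1), eF1.toLinearEquiv.finrank_eq, ← this]; rfl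
    rw [hdegKB, h2, pow_succ] at h
    exact Nat.eq_of_mul_eq_mul_left (pow_pos hp0 n) h
  -- class numbers of the layers
  have hclB : classNumber Bi = classNumber (κ.layer n) :=
    (Fintype.card_congr (ClassGroup.mulEquiv (RingOfIntegers.mapRingEquiv eB.toRingEquiv)).toEquiv).symm
  have hclF1 : classNumber F1e = classNumber (κ.layer (n + 1)) := by
    have e : (κ.layer (n + 1)) ≃+* F1e := eF1.toRingEquiv.trans eF1e
    exact (Fintype.card_congr (ClassGroup.mulEquiv (RingOfIntegers.mapRingEquiv e)).toEquiv).symm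
  -- `Gal(T/B)` is cyclic
  haveI hcycF : IsCyclic ((κ.layer (n + 2)) ≃ₐ[Bi] (κ.layer (n + 2))) := by
    obtain ⟨ψ, -, hker, -⟩ := κ.exists_cyclicCharacter_layer (n + 2)
    haveI : IsCyclic ((κ.layer (n + 2)) ≃ₐ[K] (κ.layer (n + 2))) := isCyclic_of_cyclicLayer ψ (κ.layer (n + 2)) hker
    let j : ((κ.layer (n + 2)) ≃ₐ[Bi] (κ.layer (n + 2))) →* ((κ.layer (n + 2)) ≃ₐ[K] (κ.layer (n + 2))) :=
      { toFun := fun σ => σ.restrictScalars K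
        map_one' := rfl
        map_mul' := fun _ _ => rfl }
    have hj : Function.Injective j := fun σ τ h => AlgEquiv.restrictScalars_injective K h
    exact isCyclic_of_surjective (MonoidHom.ofInjective hj).symm.toMonoidHom (MonoidHom.ofInjective hj).symm.surjective
  -- ### the Hilbert class field `(hilbertClassField (κ.layer (n + 2))) = H_T`, Galois over `Bi`
  haveI : IsGalois Bi (hilbertClassField (κ.layer (n + 2))) := hilbertClassField.isGalois_of_isGalois (κ.layer (n + 2))
  haveI : FiniteDimensional Bi (hilbertClassField (κ.layer (n + 2))) := Module.Finite.trans (κ.layer (n + 2)) (hilbertClassField (κ.layer (n + 2)))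
  haveI : IsUnramifiedAtInfinitePlaces K (κ.layer (n + 2)) := κ.isUnramifiedAtInfinitePlaces_layer (n + 2)
  haveI : IsUnramifiedAtInfinitePlaces Bi (κ.layer (n + 2)) :=
    IsUnramifiedAtInfinitePlaces.top (k := K) (K := Bi) (F := (κ.layer (n + 2)))
  haveI : IsUnramifiedAtInfinitePlaces Bi (hilbertClassField (κ.layer (n + 2))) := IsUnramifiedAtInfinitePlaces.trans Bi (κ.layer (n + 2)) (hilbertClassField (κ.layer (n + 2)))
  haveI : IsScalarTower K F1e (hilbertClassField (κ.layer (n + 2))) := IsScalarTower.of_algebraMap_eq fun _ => rfl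
  haveI : IsGalois F1e (hilbertClassField (κ.layer (n + 2))) := IsGalois.tower_top_of_isGalois Bi F1e (hilbertClassField (κ.layer (n + 2)))
  -- `G = Gal((hilbertClassField (κ.layer (n + 2)))/B)`, `A = Gal((hilbertClassField (κ.layer (n + 2)))/T) = ker (G → Gal(T/B))`
  obtain ⟨πF, hπF⟩ : ∃ πF : ((hilbertClassField (κ.layer (n + 2))) ≃ₐ[Bi] (hilbertClassField (κ.layer (n + 2)))) →* ((κ.layer (n + 2)) ≃ₐ[Bi] (κ.layer (n + 2))), πF = AlgEquiv.restrictNormalHom (κ.layer (n + 2)) :=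
    ⟨_, rfl⟩
  have hπF_surj : Function.Surjective πF := by
    rw [hπF]; exact AlgEquiv.restrictNormalHom_surjective (hilbertClassField (κ.layer (n + 2)))
  have hπF_apply : ∀ g : (hilbertClassField (κ.layer (n + 2))) ≃ₐ[Bi] (hilbertClassField (κ.layer (n + 2))), πF g = g.restrictNormal (κ.layer (n + 2)) := fun g => by rw [hπF]; rfl
  obtain ⟨A, hA⟩ : ∃ A : Subgroup ((hilbertClassField (κ.layer (n + 2))) ≃ₐ[Bi] (hilbertClassField (κ.layer (n + 2)))), A = πF.ker := ⟨_, rfl⟩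
  haveI hAn : A.Normal := by rw [hA]; infer_instance
  have hmemA : ∀ g : (hilbertClassField (κ.layer (n + 2))) ≃ₐ[Bi] (hilbertClassField (κ.layer (n + 2))), g ∈ A ↔ ∀ x : (κ.layer (n + 2)), g (algebraMap (κ.layer (n + 2)) (hilbertClassField (κ.layer (n + 2))) x) = algebraMap (κ.layer (n + 2)) (hilbertClassField (κ.layer (n + 2))) x := by
    intro g
    rw [hA, MonoidHom.mem_ker]
    constructor
    · intro h x
      have h1 := AlgEquiv.restrictNormal_commutes g (κ.layer (n + 2)) x
      rw [← hπF_apply, h, AlgEquiv.one_apply] at h1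
      exact h1.symm
    · intro h
      apply AlgEquiv.ext
      intro x
      apply (algebraMap (κ.layer (n + 2)) (hilbertClassField (κ.layer (n + 2)))).injective
      rw [AlgEquiv.one_apply, hπF_apply, AlgEquiv.restrictNormal_commutes]
      exact h x
  have toF : ∀ g ∈ A, ∃ g' : (hilbertClassField (κ.layer (n + 2))) ≃ₐ[(κ.layer (n + 2))] (hilbertClassField (κ.layer (n + 2))), ∀ x, g' x = g x := fun g hg =>
    ⟨{ g with commutes' := fun x => (hmemA g).mp hg x }, fun _ => rfl⟩
  have hAcomm : ∀ a ∈ A, ∀ b ∈ A, a * b = b * a := by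
    intro a ha b hb
    obtain ⟨a', ha'⟩ := toF a ha
    obtain ⟨b', hb'⟩ := toF b hb
    have hc : a' * b' = b' * a' := (IsAbelianGalois.toIsMulCommutative (K := ↥(κ.layer (n + 2))) (L := (hilbertClassField (κ.layer (n + 2))))).is_comm.comm a' b'
    apply AlgEquiv.ext
    intro x
    have h := congrArg (fun f : (hilbertClassField (κ.layer (n + 2))) ≃ₐ[(κ.layer (n + 2))] (hilbertClassField (κ.layer (n + 2))) => f x) hc
    simp only [AlgEquiv.mul_apply] at h ⊢
    rw [← ha', ← hb', h, hb', ha']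
  haveI : IsMulCommutative A := ⟨⟨fun a b => Subtype.ext (hAcomm a a.2 b b.2)⟩⟩
  have hAindex : A.index = p ^ 2 := by
    rw [hA, Subgroup.index_ker, MonoidHom.range_eq_top.mpr hπF_surj, Subgroup.card_top, IsGalois.card_aut_eq_finrank, hdegBF]
  have hAcard : Nat.card A = classNumber (κ.layer (n + 2)) := by
    have h1 : A.index * Nat.card A = Nat.card ((hilbertClassField (κ.layer (n + 2))) ≃ₐ[Bi] (hilbertClassField (κ.layer (n + 2)))) := A.index_mul_card
    rw [hAindex, IsGalois.card_aut_eq_finrank, ← Module.finrank_mul_finrank Bi (κ.layer (n + 2)) (hilbertClassField (κ.layer (n + 2))), hdegBF,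
      hilbertClassField.finrank_eq_classNumber] at h1
    exact Nat.eq_of_mul_eq_mul_left (pow_pos hp0 2) h1
  -- ### the prime-to-`p` part `A₀` of `A` and the `p`-Hilbert class field `Hp = (hilbertClassField (κ.layer (n + 2)))^{A₀}`
  obtain ⟨A₀', hA₀'mem, hA₀'index⟩ := exists_subgroup_index_eq_pow_padicValNat_card A p
  obtain ⟨A₀, hA₀⟩ : ∃ A₀ : Subgroup ((hilbertClassField (κ.layer (n + 2))) ≃ₐ[Bi] (hilbertClassField (κ.layer (n + 2)))), A₀ = A₀'.map A.subtype := ⟨_, rfl⟩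
  have hA₀A : A₀ ≤ A := by
    rw [hA₀]; rintro _ ⟨g, -, rfl⟩; exact g.2
  have hmemA₀ : ∀ g, g ∈ A₀ ↔ g ∈ A ∧ ¬ p ∣ orderOf g := by
    intro g
    rw [hA₀, Subgroup.mem_map]
    constructor
    · rintro ⟨g', hg', rfl⟩
      refine ⟨g'.2, ?_⟩
      rw [Subgroup.coe_subtype, Subgroup.orderOf_coe]
      exact (hA₀'mem g').mp hg'
    · rintro ⟨hgA, hg⟩
      refine ⟨⟨g, hgA⟩, (hA₀'mem _).mpr ?_, rfl⟩
      rwa [Subgroup.orderOf_mk]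
  haveI hA₀n : A₀.Normal := ⟨fun m hm g => by
    rw [hmemA₀] at hm ⊢
    refine ⟨hAn.conj_mem m hm.1 g, ?_⟩
    have : orderOf (g * m * g⁻¹) = orderOf m := by
      rw [show g * m * g⁻¹ = MulAut.conj g m from rfl]
      exact orderOf_injective (MulAut.conj g).toMonoidHom (MulAut.conj g).injective m
    rw [this]; exact hm.2⟩
  have hA₀relindex : A₀.relIndex A = p ^ padicValNat p (classNumber (κ.layer (n + 2))) := by
    rw [← hAcard, ← hA₀'index, Subgroup.relIndex, hA₀]
    congr 1
    ext g
    simp only [Subgroup.mem_subgroupOf, Subgroup.mem_map, Subgroup.coe_subtype]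
    constructor
    · rintro ⟨g', hg', hgg'⟩
      have : g' = g := Subtype.ext hgg'
      rwa [← this]
    · intro hg; exact ⟨g, hg, rfl⟩
  obtain ⟨Hp, hHp⟩ : ∃ Hp : IntermediateField Bi (hilbertClassField (κ.layer (n + 2))), Hp = IntermediateField.fixedField A₀ := ⟨_, rfl⟩
  haveI hHpGal : IsGalois Bi Hp := by rw [hHp]; exact IsGalois.of_fixedField_normal_subgroup A₀
  have hFmem : ∀ x : (κ.layer (n + 2)), algebraMap (κ.layer (n + 2)) (hilbertClassField (κ.layer (n + 2))) x ∈ Hp := by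
    intro x
    rw [hHp, IntermediateField.mem_fixedField_iff]
    intro g hg
    exact (hmemA g).mp (hA₀A hg) x
  -- `Hp` as an intermediate field OVER `T` (same carrier): `HqF`
  obtain ⟨HqF, hmemHqF⟩ : ∃ HqF : IntermediateField (κ.layer (n + 2)) (hilbertClassField (κ.layer (n + 2))), ∀ x : (hilbertClassField (κ.layer (n + 2))), x ∈ HqF ↔ x ∈ Hp :=
    ⟨Hp.toSubfield.toIntermediateField hFmem, fun _ => Iff.rfl⟩
  let eHq : Hp ≃ₐ[Bi] HqF :=
    { toFun := fun x => ⟨(x : (hilbertClassField (κ.layer (n + 2)))), (hmemHqF _).mpr x.2⟩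
      invFun := fun x => ⟨(x : (hilbertClassField (κ.layer (n + 2)))), (hmemHqF _).mp x.2⟩
      left_inv := fun _ => rfl
      right_inv := fun _ => rfl
      map_mul' := fun _ _ => rfl
      map_add' := fun _ _ => rfl
      commutes' := fun _ => rfl }
  haveI : IsGalois Bi HqF := IsGalois.of_algEquiv eHq
  haveI : FiniteDimensional Bi HqF := LinearEquiv.finiteDimensional eHq.toLinearEquiv
  haveI : NumberField HqF := NumberField.of_module_finite (κ.layer (n + 2)) HqF
  haveI : IsScalarTower Bi HqF (hilbertClassField (κ.layer (n + 2))) := IsScalarTower.of_algebraMap_eq fun _ => rfl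
  haveI : IsScalarTower Bi F1e HqF := IsScalarTower.of_algebraMap_eq fun _ => rfl
  haveI : IsScalarTower F1e HqF (hilbertClassField (κ.layer (n + 2))) := IsScalarTower.of_algebraMap_eq fun _ => rfl
  haveI : IsScalarTower K F1e HqF := IsScalarTower.of_algebraMap_eq fun _ => rfl
  haveI : IsGalois (κ.layer (n + 2)) HqF := IsGalois.tower_top_of_isGalois Bi (κ.layer (n + 2)) HqF
  haveI : IsGalois F1e HqF := IsGalois.tower_top_of_isGalois Bi F1e HqF
  haveI : IsUnramifiedAtInfinitePlaces Bi HqF := IsUnramifiedAtInfinitePlaces.bot (k := Bi) (K := HqF) (F := (hilbertClassField (κ.layer (n + 2))))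
  haveI : IsUnramifiedAtInfinitePlaces F1e HqF := IsUnramifiedAtInfinitePlaces.top (k := Bi) (K := F1e) (F := HqF)
  -- ### `Gal(H_T/T) ↪ Gal(H_T/B)` with image `A`; every `p`-power sub-extension of `H_T/T` lies in `HqF`
  let ρE : ((hilbertClassField (κ.layer (n + 2))) ≃ₐ[(κ.layer (n + 2))] (hilbertClassField (κ.layer (n + 2)))) →* ((hilbertClassField (κ.layer (n + 2))) ≃ₐ[Bi] (hilbertClassField (κ.layer (n + 2)))) :=
    { toFun := fun σ => σ.restrictScalars Bi
      map_one' := rfl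
      map_mul' := fun _ _ => rfl }
  have hρE_inj : Function.Injective ρE := fun σ τ h => AlgEquiv.restrictScalars_injective Bi h
  have hρE_surj : ∀ g ∈ A, ∃ σ, ρE σ = g := fun g hg =>
    ⟨{ g with commutes' := fun x => (hmemA g).mp hg x }, AlgEquiv.ext fun _ => rfl⟩
  have hmax : ∀ L : IntermediateField (κ.layer (n + 2)) (hilbertClassField (κ.layer (n + 2))), (∃ k, Module.finrank (κ.layer (n + 2)) L = p ^ k) → L ≤ HqF := by
    rintro L ⟨k, hk⟩ x hx
    rw [hmemHqF, hHp, IntermediateField.mem_fixedField_iff]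
    intro g hg
    obtain ⟨σ, rfl⟩ := hρE_surj g (hA₀A hg)
    have hσord : ¬ p ∣ orderOf σ := by
      have h1 := ((hmemA₀ _).mp hg).2
      rwa [orderOf_injective ρE hρE_inj σ] at h1
    set τ := AlgEquiv.restrictNormalHom L σ with hτ
    have hτ1 : τ = 1 := by
      have h1 : orderOf τ ∣ p ^ k := by
        rw [← hk, ← IsGalois.card_aut_eq_finrank]
        exact orderOf_dvd_natCard τ
      obtain ⟨j, -, hj⟩ := (Nat.dvd_prime_pow hp.out).mp h1
      have h2 : orderOf τ ∣ orderOf σ := orderOf_map_dvd _ σ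
      rcases j with _ | j
      · rwa [pow_zero, orderOf_eq_one_iff] at hj
      · exact absurd ((Dvd.intro_left _ (pow_succ p j).symm).trans (hj ▸ h2)) hσord
    have h3 := AlgEquiv.restrictNormal_commutes σ L ⟨x, hx⟩
    rw [show σ.restrictNormal L = τ from rfl, hτ1, AlgEquiv.one_apply] at h3
    exact h3.symm
  -- ### class field theory (bricks (C), (D)) for `M = B` and `M = F₁`
  have hD0 := dvd_index_of_algebra_eq Bi (κ.layer (n + 2)) p HqF hmax inferInstance (Algebra.algebra_ext _ _ fun _ => rfl) inferInstance
  have hD1 := dvd_index_of_algebra_eq F1e (κ.layer (n + 2)) p HqF hmax inferInstance (Algebra.algebra_ext _ _ fun _ => rfl) inferInstance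
  -- ### the Galois group `Gp = Gal(H_p/B)` (`H_p = HqF`), `A' = Gal(H_p/T)`, `G₁ = Gal(H_p/F₁)`
  haveI : IsScalarTower Bi (κ.layer (n + 2)) HqF := IsScalarTower.of_algebraMap_eq fun _ => rfl
  obtain ⟨res, hresdef⟩ : ∃ res : (HqF ≃ₐ[Bi] HqF) →* ((κ.layer (n + 2)) ≃ₐ[Bi] (κ.layer (n + 2))), res = AlgEquiv.restrictNormalHom (κ.layer (n + 2)) :=
    ⟨_, rfl⟩
  have hres_surj : Function.Surjective res := by
    rw [hresdef]; exact AlgEquiv.restrictNormalHom_surjective HqF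
  have hres_apply : ∀ g : HqF ≃ₐ[Bi] HqF, res g = g.restrictNormal (κ.layer (n + 2)) := fun g => by rw [hresdef]; rfl
  obtain ⟨A', hA'⟩ : ∃ A' : Subgroup (HqF ≃ₐ[Bi] HqF), A' = res.ker := ⟨_, rfl⟩
  haveI hA'n : A'.Normal := by rw [hA']; infer_instance
  have hA'index : A'.index = p ^ 2 := by
    rw [hA', Subgroup.index_ker, MonoidHom.range_eq_top.mpr hres_surj, Subgroup.card_top, IsGalois.card_aut_eq_finrank, hdegBF]
  have hcycQ : IsCyclic ((HqF ≃ₐ[Bi] HqF) ⧸ A') :=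
    isCyclic_of_surjective _ (((QuotientGroup.quotientKerEquivOfSurjective res hres_surj).symm.trans
      (QuotientGroup.quotientMulEquivOfEq hA').symm).surjective)
  have hmemA' : ∀ g : HqF ≃ₐ[Bi] HqF, g ∈ A' ↔ ∀ x : (κ.layer (n + 2)), g (algebraMap (κ.layer (n + 2)) HqF x) = algebraMap (κ.layer (n + 2)) HqF x := by
    intro g
    rw [hA', MonoidHom.mem_ker]
    constructor
    · intro h x
      have h1 := AlgEquiv.restrictNormal_commutes g (κ.layer (n + 2)) x
      rw [← hres_apply, h, AlgEquiv.one_apply] at h1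
      exact h1.symm
    · intro h
      apply AlgEquiv.ext
      intro x
      apply (algebraMap (κ.layer (n + 2)) HqF).injective
      rw [AlgEquiv.one_apply, hres_apply, AlgEquiv.restrictNormal_commutes]
      exact h x
  let ρT : (HqF ≃ₐ[(κ.layer (n + 2))] HqF) →* (HqF ≃ₐ[Bi] HqF) :=
    { toFun := fun σ => σ.restrictScalars Bi
      map_one' := rfl
      map_mul' := fun _ _ => rfl }
  have hρT_inj : Function.Injective ρT := fun σ τ h => AlgEquiv.restrictScalars_injective Bi h
  have hρT_range : ρT.range = A' := by
    ext g
    constructor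
    · rintro ⟨σ, rfl⟩
      exact (hmemA' _).mpr fun x => σ.commutes x
    · intro hg
      exact ⟨{ g with commutes' := fun x => (hmemA' g).mp hg x }, AlgEquiv.ext fun _ => rfl⟩
  have hA'comm : ∀ a ∈ A', ∀ b ∈ A', a * b = b * a := by
    intro a ha b hb
    rw [← hρT_range] at ha hb
    obtain ⟨σ, rfl⟩ := ha
    obtain ⟨τ, rfl⟩ := hb
    rw [← map_mul, ← map_mul, (IsAbelianGalois.toIsMulCommutative (K := ↥(κ.layer (n + 2))) (L := ↥HqF)).is_comm.comm σ τ]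
  haveI : IsMulCommutative A' := ⟨⟨fun a b => Subtype.ext (hA'comm a a.2 b b.2)⟩⟩
  -- `#Gp = p² · p^{e_{n+2}}`, `#A' = p^{e_{n+2}}`
  have hA₀card : p ^ padicValNat p (classNumber (κ.layer (n + 2))) * Nat.card A₀ = classNumber (κ.layer (n + 2)) := by
    rw [← hA₀relindex, ← hAcard, Subgroup.relIndex,
      ← Nat.card_congr (Subgroup.subgroupOfEquivOfLe hA₀A).toEquiv]
    exact Subgroup.index_mul_card _
  have hA₀pos : 0 < Nat.card A₀ := Nat.card_pos
  haveI : Module.Free Bi Hp := Module.Free.of_divisionRing Bi Hp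
  haveI : Module.Free Hp (hilbertClassField (κ.layer (n + 2))) := Module.Free.of_divisionRing Hp _
  haveI : Module.Free Bi (hilbertClassField (κ.layer (n + 2))) := Module.Free.of_divisionRing Bi _
  haveI : Module.Free (κ.layer (n + 2)) (hilbertClassField (κ.layer (n + 2))) := Module.Free.of_divisionRing _ _
  haveI : Module.Free Bi (κ.layer (n + 2)) := Module.Free.of_divisionRing Bi _
  have hdegHp : Module.finrank Bi HqF = p ^ 2 * p ^ padicValNat p (classNumber (κ.layer (n + 2))) := by
    rw [← eHq.toLinearEquiv.finrank_eq]
    have h1 := Module.finrank_mul_finrank Bi Hp (hilbertClassField (κ.layer (n + 2)))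
    rw [hHp, IntermediateField.finrank_fixedField_eq_card A₀, ← hHp,
      ← Module.finrank_mul_finrank Bi (κ.layer (n + 2)) (hilbertClassField (κ.layer (n + 2))), hdegBF, hilbertClassField.finrank_eq_classNumber,
      ← hA₀card, ← mul_assoc] at h1
    exact Nat.eq_of_mul_eq_mul_right hA₀pos h1
  have hGpcard : Nat.card (HqF ≃ₐ[Bi] HqF) = p ^ 2 * p ^ padicValNat p (classNumber (κ.layer (n + 2))) := by
    rw [IsGalois.card_aut_eq_finrank, hdegHp]
  have hA'card : Nat.card A' = p ^ padicValNat p (classNumber (κ.layer (n + 2))) := by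
    have h1 := A'.index_mul_card
    rw [hA'index, hGpcard] at h1
    exact Nat.eq_of_mul_eq_mul_left (pow_pos hp0 2) h1
  have hApg : IsPGroup p A' := IsPGroup.of_card hA'card
  -- `G₁ = Gal(H_p/F₁)` as the image of restriction of scalars
  let ρ1 : (HqF ≃ₐ[F1e] HqF) →* (HqF ≃ₐ[Bi] HqF) :=
    { toFun := fun σ => σ.restrictScalars Bi
      map_one' := rfl
      map_mul' := fun _ _ => rfl }
  have hρ1_inj : Function.Injective ρ1 := fun σ τ h => AlgEquiv.restrictScalars_injective Bi h
  obtain ⟨G₁, hG₁⟩ : ∃ G₁ : Subgroup (HqF ≃ₐ[Bi] HqF), G₁ = ρ1.range := ⟨_, rfl⟩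
  haveI : Module.Free F1e HqF := Module.Free.of_divisionRing F1e HqF
  haveI : Module.Free Bi F1e := Module.Free.of_divisionRing Bi F1e
  haveI : Module.Free Bi HqF := Module.Free.of_divisionRing Bi HqF
  have hG1card : Nat.card (HqF ≃ₐ[F1e] HqF) = p * p ^ padicValNat p (classNumber (κ.layer (n + 2))) := by
    have h1 := Module.finrank_mul_finrank Bi F1e HqF
    rw [hdegBF1, hdegHp, pow_two, mul_assoc] at h1
    rw [IsGalois.card_aut_eq_finrank]
    exact Nat.eq_of_mul_eq_mul_left hp0 h1
  have hG₁index : G₁.index = p := by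
    rw [hG₁]
    have h1 := ρ1.range.index_mul_card
    rw [← Nat.card_congr (MonoidHom.ofInjective hρ1_inj).toEquiv, hG1card, hGpcard, pow_two, mul_assoc] at h1
    exact Nat.eq_of_mul_eq_mul_right (mul_pos hp0 (pow_pos hp0 _)) h1
  have hA'G₁ : A' ≤ G₁ := by
    intro g hg
    rw [← hρT_range] at hg
    obtain ⟨σ, rfl⟩ := hg
    rw [hG₁]
    exact ⟨σ.restrictScalars F1e, AlgEquiv.ext fun _ => rfl⟩
  -- ### inertia groups: `I(𝔔) ≤ Gp` meets `A'` trivially and is trivial or a complement of `A'`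
  -- (1) `H_p/T` is unramified: `#I_{Gal(H_p/T)}(𝔔) = e(𝔔|T) = 1`
  have heT : ∀ (Q : Ideal (𝓞 HqF)) [Q.IsMaximal], Q.ramificationIdx (𝓞 (κ.layer (n + 2))) = 1 := by
    intro Q _
    obtain ⟨P, hPmax, hPQ⟩ := Ideal.exists_maximal_ideal_liesOver_of_isIntegral (S := 𝓞 (hilbertClassField (κ.layer (n + 2)))) Q
    haveI := hPmax
    haveI := hPQ
    haveI := hilbertClassField.isUnramifiedAt (κ.layer (n + 2)) P
    have h1 : P.ramificationIdx (𝓞 (κ.layer (n + 2))) = 1 := Ideal.ramificationIdx_eq_one P (𝓞 (κ.layer (n + 2)))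
    rw [Ideal.ramificationIdx_tower Q P] at h1
    exact Nat.eq_one_of_mul_eq_one_right h1
  -- (2) `#I_{Gp}(𝔔) = e(𝔔 ∩ T | B) = #I_{Gal(T/B)}(𝔔 ∩ T)`
  have hcardI : ∀ (Q : Ideal (𝓞 HqF)) [Q.IsMaximal],
      Nat.card (Q.inertia (HqF ≃ₐ[Bi] HqF)) = Nat.card ((Q.under (𝓞 (κ.layer (n + 2)))).inertia ((κ.layer (n + 2)) ≃ₐ[Bi] (κ.layer (n + 2)))) := by
    intro Q _
    haveI : (Q.under (𝓞 (κ.layer (n + 2)))).IsMaximal := Ideal.IsMaximal.under (𝓞 (κ.layer (n + 2))) Q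
    rw [card_inertia_eq_ramificationIdx HqF (HqF ≃ₐ[Bi] HqF) Bi Q,
      card_inertia_eq_ramificationIdx (κ.layer (n + 2)) ((κ.layer (n + 2)) ≃ₐ[Bi] (κ.layer (n + 2))) Bi (Q.under (𝓞 (κ.layer (n + 2)))),
      Ideal.ramificationIdx_tower (Q.under (𝓞 (κ.layer (n + 2)))) Q, heT Q, mul_one]
  -- (3) dichotomy downstairs (brick (R)): `I_{Gal(T/B)}(𝔮) = 1` or `= Gal(T/B)`
  have htop_of : ∀ (q : Ideal (𝓞 (κ.layer (n + 2)))) [q.IsMaximal],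
      (∀ g : (κ.layer (n + 2)) ≃ₐ[K] (κ.layer (n + 2)), (∀ x : (κ.layer (n + 2)), (x : AlgebraicClosure K) ∈ κ.layer n → g x = x) →
        g ∈ q.inertia ((κ.layer (n + 2)) ≃ₐ[K] (κ.layer (n + 2)))) → q.inertia ((κ.layer (n + 2)) ≃ₐ[Bi] (κ.layer (n + 2))) = ⊤ := by
    intro q _ h
    rw [eq_top_iff]
    intro σ _
    have h1 : σ.restrictScalars K ∈ q.inertia ((κ.layer (n + 2)) ≃ₐ[K] (κ.layer (n + 2))) := by
      apply h
      intro x hx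
      have hxB : x ∈ Bi := by rw [hBi, IntermediateField.mem_restrict]; exact hx
      exact σ.commutes ⟨x, hxB⟩
    exact fun y => h1 y
  have hdich : ∀ (q : Ideal (𝓞 (κ.layer (n + 2)))) [q.IsMaximal],
      q.inertia ((κ.layer (n + 2)) ≃ₐ[Bi] (κ.layer (n + 2))) = ⊥ ∨ q.inertia ((κ.layer (n + 2)) ≃ₐ[Bi] (κ.layer (n + 2))) = ⊤ := by
    intro q _
    rcases κ.inertia_layer_eq_bot_or_forall_mem hκ hn (Nat.le_add_right n 2) q with h1 | h2
    · left
      rw [eq_bot_iff]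
      intro σ hσ
      have h3 : σ.restrictScalars K ∈ q.inertia ((κ.layer (n + 2)) ≃ₐ[K] (κ.layer (n + 2))) := fun y => hσ y
      rw [h1, Subgroup.mem_bot] at h3
      rw [Subgroup.mem_bot]
      apply AlgEquiv.restrictScalars_injective K
      rw [h3]
      rfl
    · exact Or.inr (htop_of q h2)
  -- (4) upstairs: `I(𝔔) ⊓ A' = 1`, and `I(𝔔) = 1` or `I(𝔔) ⊔ A' = Gp`
  have hinf : ∀ (Q : Ideal (𝓞 HqF)) [Q.IsMaximal], Q.inertia (HqF ≃ₐ[Bi] HqF) ⊓ A' = ⊥ := by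
    intro Q _
    have h1 : (Q.inertia (HqF ≃ₐ[(κ.layer (n + 2))] HqF)).map ρT = Q.inertia (HqF ≃ₐ[Bi] HqF) ⊓ A' := by
      ext g
      constructor
      · rintro ⟨σ, hσ, rfl⟩
        exact ⟨fun y => hσ y, hρT_range ▸ ⟨σ, rfl⟩⟩
      · rintro ⟨hgI, hgA⟩
        rw [← hρT_range] at hgA
        obtain ⟨σ, rfl⟩ := hgA
        exact ⟨σ, fun y => hgI y, rfl⟩
    rw [← h1, ← Subgroup.card_eq_one, Subgroup.card_map_of_injective hρT_inj,
      card_inertia_eq_ramificationIdx HqF (HqF ≃ₐ[(κ.layer (n + 2))] HqF) (κ.layer (n + 2)) Q, heT Q]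
  have hsup : ∀ (Q : Ideal (𝓞 HqF)) [Q.IsMaximal], Nat.card (Q.inertia (HqF ≃ₐ[Bi] HqF)) = p ^ 2 →
      Q.inertia (HqF ≃ₐ[Bi] HqF) ⊔ A' = ⊤ := by
    intro Q _ hc
    have h1 : A'.relIndex (Q.inertia (HqF ≃ₐ[Bi] HqF) ⊔ A') = p ^ 2 := by
      rw [Subgroup.relIndex_sup_right, Subgroup.relIndex,
        Subgroup.subgroupOf_eq_bot.mpr (disjoint_iff.mpr ((inf_comm _ _).trans (hinf Q))), Subgroup.index_bot, hc]
    have h2 := Subgroup.relIndex_mul_index (le_sup_right : A' ≤ Q.inertia (HqF ≃ₐ[Bi] HqF) ⊔ A')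
    rw [h1, hA'index] at h2
    exact Subgroup.index_eq_one.mp (Nat.eq_of_mul_eq_mul_left (pow_pos hp0 2) (h2.trans (mul_one _).symm))
  have hcases : ∀ (Q : Ideal (𝓞 HqF)) [Q.IsMaximal],
      Q.inertia (HqF ≃ₐ[Bi] HqF) = ⊥ ∨ Q.inertia (HqF ≃ₐ[Bi] HqF) ⊔ A' = ⊤ := by
    intro Q _
    haveI : (Q.under (𝓞 (κ.layer (n + 2)))).IsMaximal := Ideal.IsMaximal.under (𝓞 (κ.layer (n + 2))) Q
    rcases hdich (Q.under (𝓞 (κ.layer (n + 2)))) with h1 | h2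
    · left
      rw [← Subgroup.card_eq_one, hcardI Q, h1, Subgroup.card_bot]
    · right
      apply hsup Q
      rw [hcardI Q, h2, Subgroup.card_top, IsGalois.card_aut_eq_finrank, hdegBF]
  -- (5) some `I(𝔔)` is a complement of `A'` (a prime of `T` totally ramified over `B = K_n`)
  have hexists : ∃ (Q : Ideal (𝓞 HqF)) (_ : Q.IsMaximal), Q.inertia (HqF ≃ₐ[Bi] HqF) ⊔ A' = ⊤ := by
    obtain ⟨q, hqmax, hq⟩ := κ.exists_isMaximal_forall_mem_inertia hκ hn (Nat.le_add_right n 2) (by omega)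
    haveI := hqmax
    obtain ⟨Q, hQmax, hQq⟩ := Ideal.exists_maximal_ideal_liesOver_of_isIntegral (S := 𝓞 HqF) q
    haveI := hQmax
    refine ⟨Q, hQmax, hsup Q ?_⟩
    rw [hcardI Q, ← hQq.over, htop_of q hq, Subgroup.card_top, IsGalois.card_aut_eq_finrank, hdegBF]
  -- ### the subgroups `N_M = Gal(H_p/M)'·⟨inertia⟩` (`M = B, F₁`) have index `p^{e(M)}` (bricks (C), (D))
  obtain ⟨N0, hN0⟩ : ∃ N0 : Subgroup (HqF ≃ₐ[Bi] HqF), N0 =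
      ⁅(⊤ : Subgroup (HqF ≃ₐ[Bi] HqF)), ⊤⁆ ⊔ ⨆ (Q : MaximalSpectrum (𝓞 HqF)), Q.asIdeal.inertia (HqF ≃ₐ[Bi] HqF) :=
    ⟨_, rfl⟩
  obtain ⟨N1, hN1⟩ : ∃ N1 : Subgroup (HqF ≃ₐ[F1e] HqF), N1 =
      ⁅(⊤ : Subgroup (HqF ≃ₐ[F1e] HqF)), ⊤⁆ ⊔ ⨆ (Q : MaximalSpectrum (𝓞 HqF)), Q.asIdeal.inertia (HqF ≃ₐ[F1e] HqF) :=
    ⟨_, rfl⟩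
  haveI hN0n : N0.Normal := by rw [hN0]; exact normal_of_commutator_le le_sup_left
  haveI hN1n : N1.Normal := by rw [hN1]; exact normal_of_commutator_le le_sup_left
  have hC0 : N0.index ∣ classNumber Bi :=
    index_dvd_classNumber_of_commutator_le_of_inertia_le Bi HqF N0 (by rw [hN0]; exact le_sup_left) fun Q _ => by
      rw [hN0]
      exact le_sup_of_le_right
        (le_iSup (fun Q : MaximalSpectrum (𝓞 HqF) => Q.asIdeal.inertia (HqF ≃ₐ[Bi] HqF)) ⟨Q, ‹_›⟩)
  have hC1 : N1.index ∣ classNumber F1e :=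
    index_dvd_classNumber_of_commutator_le_of_inertia_le F1e HqF N1 (by rw [hN1]; exact le_sup_left) fun Q _ => by
      rw [hN1]
      exact le_sup_of_le_right
        (le_iSup (fun Q : MaximalSpectrum (𝓞 HqF) => Q.asIdeal.inertia (HqF ≃ₐ[F1e] HqF)) ⟨Q, ‹_›⟩)
  have hpow : ∀ {G' : Type} [Group G'] (N : Subgroup G') (h k e : ℕ), Nat.card G' = p ^ k → h ≠ 0 →
      N.index ∣ h → p ^ e ∣ N.index → e = padicValNat p h → N.index = p ^ e := by
    intro G' _ N h k e hG hh hdvd hpdvd he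
    obtain ⟨j, -, hj⟩ := (Nat.dvd_prime_pow hp.out).mp (hG ▸ N.index_dvd_card)
    rw [hj] at hdvd hpdvd ⊢
    have h1 : e ≤ j := (Nat.pow_dvd_pow_iff_le_right hp.out.one_lt).mp hpdvd
    have h2 : j ≤ padicValNat p h := (padicValNat_dvd_iff_le hh).mp hdvd
    congr 1
    omega
  have hclBne : classNumber Bi ≠ 0 := Fintype.card_ne_zero
  have hclF1ne : classNumber F1e ≠ 0 := Fintype.card_ne_zero
  have hN0index : N0.index = p ^ padicValNat p (classNumber Bi) :=
    hpow N0 (classNumber Bi) _ _ (hGpcard.trans (pow_add p 2 _).symm) hclBne hC0 (by rw [hN0]; exact hD0) rfl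
  have hN1index : N1.index = p ^ padicValNat p (classNumber F1e) :=
    hpow N1 (classNumber F1e) _ _ (hG1card.trans (pow_succ' p _).symm) hclF1ne hC1 (by rw [hN1]; exact hD1) rfl
  -- ### transport `N₁` into `Gp` along `ρ₁`, and Fukuda's group-theoretic step (brick (G))
  obtain ⟨𝓘, h𝓘def⟩ : ∃ 𝓘 : Set (Subgroup (HqF ≃ₐ[Bi] HqF)),
      𝓘 = Set.range (fun Q : MaximalSpectrum (𝓞 HqF) => Q.asIdeal.inertia (HqF ≃ₐ[Bi] HqF)) := ⟨_, rfl⟩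
  have hN0' : ⁅(⊤ : Subgroup (HqF ≃ₐ[Bi] HqF)), ⊤⁆ ⊔ ⨆ I ∈ 𝓘, I = N0 := by
    rw [hN0, h𝓘def, iSup_range]
  have hmapI : ∀ Q : MaximalSpectrum (𝓞 HqF),
      (Q.asIdeal.inertia (HqF ≃ₐ[F1e] HqF)).map ρ1 = Q.asIdeal.inertia (HqF ≃ₐ[Bi] HqF) ⊓ ρ1.range := by
    intro Q
    ext g
    constructor
    · rintro ⟨σ, hσ, rfl⟩
      exact ⟨fun y => hσ y, ⟨σ, rfl⟩⟩
    · rintro ⟨hgI, ⟨σ, rfl⟩⟩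
      exact ⟨σ, fun y => hgI y, rfl⟩
  have hN1' : N1.map ρ1 = ⁅G₁, G₁⁆ ⊔ ⨆ I ∈ 𝓘, I ⊓ G₁ := by
    rw [hG₁, hN1, Subgroup.map_sup, Subgroup.map_commutator, ← MonoidHom.range_eq_map, Subgroup.map_iSup, h𝓘def,
      iSup_range]
    simp_rw [hmapI]
  have hrel : (⁅G₁, G₁⁆ ⊔ ⨆ I ∈ 𝓘, I ⊓ G₁).relIndex G₁ = (⁅(⊤ : Subgroup (HqF ≃ₐ[Bi] HqF)), ⊤⁆ ⊔ ⨆ I ∈ 𝓘, I).index := by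
    rw [← hN1', hN0', hG₁, MonoidHom.range_eq_map, Subgroup.relIndex_map_map_of_injective N1 ⊤ hρ1_inj,
      Subgroup.relIndex_top_right, hN1index, hN0index, hclF1, hclB]
    -- `e_{n+1} = e_n`
    unfold classNumberPExp at he
    rw [Nat.card_eq_fintype_card, Nat.card_eq_fintype_card] at he
    exact congrArg (p ^ ·) he
  have h𝓘 : ∀ I ∈ 𝓘, I ⊓ A' = ⊥ ∧ (I = ⊥ ∨ I ⊔ A' = ⊤) := by
    intro I hI
    rw [h𝓘def] at hI
    obtain ⟨Q, rfl⟩ := hI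
    haveI := Q.isMaximal
    exact ⟨hinf Q.asIdeal, hcases Q.asIdeal⟩
  have h𝓘₁ : ∃ I ∈ 𝓘, I ⊔ A' = ⊤ := by
    obtain ⟨Q, hQ, h⟩ := hexists
    refine ⟨_, ?_, h⟩
    rw [h𝓘def]
    exact ⟨⟨Q, hQ⟩, rfl⟩
  have hG := FukudaGroup.index_eq_card_of_relIndex_eq_index hApg hA'index hcycQ 𝓘 h𝓘 h𝓘₁ G₁ hA'G₁ hG₁index hrel
  -- ### conclusion: `p^{e_n} = [Gp : N₀] = #A' = p^{e_{n+2}}`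
  rw [hN0', hN0index, hA'card, hclB] at hG
  have hG' := Nat.pow_right_injective hp.out.two_le hG
  rw [he]
  unfold classNumberPExp
  rw [Nat.card_eq_fintype_card, Nat.card_eq_fintype_card]
  exact hG'.symm

/-- **Fukuda 1994, Theorem 1 (1)** — PROOF of the named fact `fukuda1994_thm1_classNumberPExp_const_of_succ_eq`: for a
`ℤ_p`-extension `κ` of a number field `K` with Fukuda index `n₀` (`TotallyRamifiedFrom κ n₀`), if `e_{n+1} = e_n` for some
`n ≥ n₀` then `e_m = e_n` for every `m ≥ n` (`p^{e_m} ∥ h(K_m)`); by induction from `classNumberPExp_add_two_eq`.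
[cite: Fukuda1994, Thm. 1 (1), p. 264] [cite: Washington1997, §13.3 Prop. 13.22 and Lemma 13.18] -/
theorem fukuda1994_thm1_classNumberPExp_const_of_succ_eq_holds :
    fukuda1994_thm1_classNumberPExp_const_of_succ_eq := by
  intro K _ _ p _ κ n₀ hκ n hn he m hm
  suffices h : ∀ k, classNumberPExp κ (n + k + 1) = classNumberPExp κ (n + k) ∧
      classNumberPExp κ (n + k) = classNumberPExp κ n by
    obtain ⟨k, rfl⟩ := Nat.exists_eq_add_of_le hm
    exact (h k).2
  intro k
  induction k with
  | zero => exact ⟨he, rfl⟩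
  | succ k ih =>
    have h1 : classNumberPExp κ (n + k + 2) = classNumberPExp κ (n + k + 1) :=
      classNumberPExp_add_two_eq κ hκ (hn.trans (Nat.le_add_right n k)) ih.1
    refine ⟨?_, ?_⟩
    · rw [show n + (k + 1) + 1 = n + k + 2 by ring, show n + (k + 1) = n + k + 1 by ring]
      exact h1
    · rw [show n + (k + 1) = n + k + 1 by ring, ih.1]
      exact ih.2

end Literature.NumberTheory.IwasawaTheory

end
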